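import Summits.AnomalousDissipation.AnomalousDissipation.Theorems.GalerkinSteadyZerothLaw.Negative.StokesStates
import Summits.AnomalousDissipation.AnomalousDissipation.Theorems.MirrorVarietyGalerkinSteadyZerothLawCellCore
import Literature.Analysis.FluidPDE.NSGalerkinStationary

/-!
# Line `idea-sketch-ideator2` (card `euler-core-coat-readout`) — crux `MirrorVariety.GalerkinSteadyZerothLaw`
# (stmt-AnomalousDissipation-2986), lead's skeleton v4 (lead c1, 2026-08-17): the heart in FORCE coordinates

Crux (the route's Thesis X, fixed): SOME smooth div-free mean-zero force `f` on `T³`, SOME `ν_j → 0⁺`, `E`, `ε > 0`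
such that for every `j` and FREQUENTLY in the resolution `N` there is an admissible Galerkin steady state `U`
(tested form) with `∫|U|² ≤ E` and `ν_j‖∇U‖² ≥ ε`.

History of the line.  v1–v3b (lead -2986-0): the card's clamp/coat/readout/gauge mechanism was typed and the crux was
reduced to the heart `stub_loudCoatDecades` (loud bounded CONNECTED coat families of one exact-Euler core over clamp-viscosity
decades) through `stub_coreForce` (p86114), `stub_decadeIVT` (p86728), `stub_coatWitness` (p87544), composition `line_glue`
(p88897); the chart is onto (`coat_chart_onto`, p90004) and the heart's typed shell landed (p132362, p132683, p132744, p132934,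
p133198, p133497), reducing it BY LANDED THEOREMS to a steady tube ladder of the FIXED cell force
(`loudCoatDecades_of_cellLadder`).

v4 (this file).  In force coordinates the clamp, the gauge and the decade sweep are not needed for the TRANSFER at all: the
crux at `f :=` the cell field needs exactly ONE loud bounded Galerkin steady state of the fixed cell force per `(j, N)`.  So the
registered heart is now `stub_cellLoud` — the crux's own matrix for the explicit force
`(sin 2πx cos 2πy, −cos 2πx sin 2πy, 0)` at the coefficient level — and the composition is the coefficient → field dictionary:
* `stub_coreForce` (S; LANDED p86114 as `Theorems.GalerkinSteadyZerothLaw.stub_coreForce`; its module has no farm olean at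
  the time of writing, so the 15-line proof is repeated here verbatim — to be replaced by the import when the module builds):
  the field `fieldOf N₀ C₀` of a real solenoidal coefficient vector is smooth, divergence free, mean zero, and its Fourier force
  vector at EVERY level `N` is the zero-extension of `C₀` read on `modes N`;
* `stub_cellLoud` (LOAD-BEARING = the crux for the cell force; the ONLY `sorry`): budgets `E`, `ε > 0` and viscosities
  `a j → 0⁺` such that for every `j`, frequently in `N`, the stationary Galerkin field of the cell force at viscosity `a j` has
  a real solenoidal zero `c` with `energy c ≤ E` and `dissipation (a j) c ≥ ε`;
* `GalerkinSteadyZerothLaw_of` — kernel-checked composition (no `sorry` outside the stubs), concluding the route decl BY NAME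
  through the landed `Negative.crux_iff`: `f := fieldOf 2 cellCoeff↾` (smooth, div-free, mean-zero by `stub_coreForce`; its force
  vector at level `N` is `cellCoeff↾` because `cellCoeff` is supported in `modes 2`, `stub_cellCoreTools.1`), and each zero `c`
  becomes the admissible tested-form state `fieldOf N c` (`steadyState_fieldOf`) with `∫|U|² = energy c` and
  `ν‖∇U‖² = dissipation ν c` (Parseval: `integral_norm_sq_fieldOf`, `loudness_fieldOf`).

What the coat mechanism still is: the FINDER.  Trivial coats = the laminar branch `C/(8π²ν)`; rungs of the clamped pencil
`νA + L_C` = its 3-D bifurcation points; coat continuation + gauge = continuation of the bifurcating steady branches of the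
cell-forced system (kit rounds j015550–j016175 of lead -2986-0: loud bounded 3-D families at N = 6, 8, 10, not N-converged).
The ladder form stays available: `loudCoatDecades_of_cellLadder` + `line_glue` (landed), and a ladder covering `[a j, r·a j]`
trivially contains a state AT `a j`, i.e. gives `stub_cellLoud`.

Disproof used (`Cruxes/GalerkinSteadyZerothLaw/Disproof.lean`, cdisprove cycles 1–2, NO KILL): §3 load-bearing obligations
(bounded energy ∧ loud ∧ `ν → 0`, `E` uniform in `j`) are verbatim the three clauses of `stub_cellLoud`; §2 budget window
`ε² ≤ E∫‖f‖² = E/2` and the resolution diagonal `N ≥ (ε/4π²a_jE)^{1/2}` constrain its constants; §4 dimension: every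
x₃-independent steady state of the cell force is quiet (horizontal part planar — `planar_loudness_sq_le`; vertical part a steady
passive scalar with `f₃ = 0`, so `ν‖∇u₃‖² = (f₃,u₃) = 0`), hence witnesses are genuinely 3-D; §5 `not_crux_iff`: the stub's
negation is uniform-in-`N` laminarisation of bounded cell-forced steady Galerkin states — the disprover's concrete target.
`-- Targets`: none handed over yet.  Negatives index (13037, 2859, 2979, 2984, 0204): no instance relation with the stub.
-/

noncomputable section

set_option linter.dupNamespace false

open scoped InnerProductSpace Topology
open MeasureTheory Filter Set UnitAddTorus
open Literature.Analysis.FunctionSpaces Literature.Analysis.FunctionSpaces.Torus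
open Literature.Analysis.FluidPDE Literature.Analysis.FluidPDE.Torus

namespace Summit.AnomalousDissipation.AnomalousDissipation.Cruxes.GalerkinSteadyZerothLaw.EulerCoreCoatReadout

open Summit.AnomalousDissipation.AnomalousDissipation.Theses.MirrorVariety (GalerkinSteadyZerothLaw)
open Summit.AnomalousDissipation.AnomalousDissipation.Theorems.GalerkinSteadyZerothLaw.Negative
  (SteadyState BandLimited FrequentlyLoud LoudWitness crux_iff fieldOf steadyState_fieldOf integral_norm_sq_fieldOf
    loudness_fieldOf)
open Summit.AnomalousDissipation.AnomalousDissipation.Theorems.GalerkinSteadyZerothLaw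
  (cellCoeff cellShell stub_cellCoreTools)
open Summit.AnomalousDissipation.AnomalousDissipation.Theorems.LaminarNeverLoud.Negative
  (modes forceCoeff energy dissipation modes_symm zero_not_mem_modes energy_nonneg dissipation_nonpos_of_nonpos
    isRealCoeff_forceCoeff)

/-! ## §1 Registered stubs -/

/-- **stub_coreForce** (S; LANDED p86114 as `Theorems.GalerkinSteadyZerothLaw.stub_coreForce` — proof repeated verbatim because
that module has no farm olean yet).  The force field of a core: for `C₀` real and solenoidal at level `N₀`, the field
`f := fieldOf N₀ C₀ = realTrigPoly (modes N₀) (coeffExt C₀)` is smooth, divergence free and mean zero, and its Fourier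
force vector at EVERY level `N` is the zero-extension of `C₀` restricted to `modes N` (`mFourierCoeff_realTrigPoly`).
[folklore] -/
theorem stub_coreForce : ∀ (N₀ : ℕ) (C₀ : ↥(modes (Fin 3) N₀) → EuclideanSpace ℂ (Fin 3)),
    C₀ ∈ galerkinSubspace (modes (Fin 3) N₀) →
    IsSmooth (fieldOf N₀ C₀) ∧ IsDivFree (fieldOf N₀ C₀) ∧ HasZeroMean (fieldOf N₀ C₀) ∧
      ∀ N : ℕ, forceCoeff (modes (Fin 3) N) (fieldOf N₀ C₀) =
        fun k : ↥(modes (Fin 3) N) => coeffExt (modes (Fin 3) N₀) C₀ k := by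
  intro N₀ C₀ hC₀
  have hS : ∀ k ∈ modes (Fin 3) N₀, -k ∈ modes (Fin 3) N₀ := modes_symm N₀
  have hS0 : (0 : Fin 3 → ℤ) ∉ modes (Fin 3) N₀ := zero_not_mem_modes N₀
  have hCsymm : IsConjSymm (coeffExt (modes (Fin 3) N₀) C₀) := hC₀.1.isConjSymm_coeffExt hS
  have hCT : IsTransversal (modes (Fin 3) N₀) (coeffExt (modes (Fin 3) N₀) C₀) :=
    hC₀.2.isTransversal_coeffExt
  refine ⟨isSmooth_realTrigPoly _ _, isDivFree_realTrigPoly hCT, hasZeroMean_realTrigPoly_of_zero_not_mem hS0 _,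
    fun N => ?_⟩
  funext k
  show mFourierCoeff (EuclideanSpace.complexify ∘ realTrigPoly (modes (Fin 3) N₀) (coeffExt (modes (Fin 3) N₀) C₀))
      (k : Fin 3 → ℤ) = coeffExt (modes (Fin 3) N₀) C₀ k
  rw [mFourierCoeff_realTrigPoly hS hCsymm]
  split_ifs with hk
  · rfl
  · exact (coeffExt_of_not_mem C₀ hk).symm

/-- **stub_cellLoud** (LOAD-BEARING — the crux's open content for the line's designated force, in force coordinates).
For the FIXED cell force `(sin 2πx cos 2πy, −cos 2πx sin 2πy, 0)` (Fourier family `cellCoeff`: `(i l₀ l₁ / 4) • l^⊥` on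
the shell `(±1, ±1, 0)`, `∫|f|² = 1/2`): budgets `E`, `ε > 0` and viscosities `a j → 0⁺` such that for every `j`,
FREQUENTLY in the resolution `N`, the stationary Galerkin field at viscosity `a j` driven by the cell force has a real
solenoidal zero `c` on the punctured ball `modes (Fin 3) N` with coefficient energy `∑‖c k‖² ≤ E` and coefficient
dissipation `a j · 4π² ∑ |k|²‖c k‖² ≥ ε`.  Intended witnesses: the 3-D steady branches bifurcating from the laminar state
`cellCoeff/(8π² a)` at the rungs of the pencil `(L_C, A)` (z-reflection class), continued to small viscosity; every witness
is necessarily x₃-DEPENDENT (Disproof §4 + `f₃ = 0`) and lives on the resolution diagonal `N ≥ (ε/4π² a_j E)^{1/2}`. -/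
theorem stub_cellLoud : ∃ (E ε : ℝ) (a : ℕ → ℝ), 0 < ε ∧ (∀ j, 0 < a j) ∧ Tendsto a atTop (𝓝 0) ∧
    ∀ j, ∃ᶠ N in atTop, ∃ c : ↥(modes (Fin 3) N) → EuclideanSpace ℂ (Fin 3),
      c ∈ galerkinSubspace (modes (Fin 3) N) ∧
      galerkinRHS (modes (Fin 3) N) (a j) (fun k : ↥(modes (Fin 3) N) => cellCoeff k) c = 0 ∧
      energy c ≤ E ∧ ε ≤ dissipation (a j) c := by
  sorry

/-! ## §2 Composition (kernel-checked; no `sorry` outside `stub_cellLoud`) -/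

/-- The cell force vector read at level `2` (the reference level carrying the shell `|l|² = 2`). -/
abbrev cellC₂ : ↥(modes (Fin 3) 2) → EuclideanSpace ℂ (Fin 3) := fun k => cellCoeff k

/-- The zero-extension of `cellC₂` is the whole family `cellCoeff` (support in `modes 2`). [folklore] -/
theorem coeffExt_cellC₂ : coeffExt (modes (Fin 3) 2) cellC₂ = cellCoeff := by
  funext k
  by_cases hk : k ∈ modes (Fin 3) 2
  · rw [coeffExt_of_mem _ hk]
  · rw [coeffExt_of_not_mem _ hk, stub_cellCoreTools.1 k hk]

/-- **Composition of the line, v4** (`stub_coreForce` and `stub_cellLoud` prove the crux BY NAME).  Force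
`f := fieldOf 2 cellC₂` (the cell field); at each `j` and each of the frequently many `N`, the zero `c` of the stationary
Galerkin field of the cell force at viscosity `a j` is turned into the admissible tested-form state `fieldOf N c` by the
landed bridge `steadyState_fieldOf`, with `∫|U|² = energy c ≤ E` and `a_j‖∇U‖² = dissipation (a j) c ≥ ε` by Parseval.
[folklore] -/
theorem GalerkinSteadyZerothLaw_of : GalerkinSteadyZerothLaw := by
  obtain ⟨E, ε, a, hε, ha, hlim, hloud⟩ := stub_cellLoud
  have hC₂ : cellC₂ ∈ galerkinSubspace (modes (Fin 3) 2) := (stub_cellCoreTools.2 2 le_rfl).1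
  obtain ⟨hfs, hfd, hfm, hfcoeff⟩ := stub_coreForce 2 cellC₂ hC₂
  have hfmem : MemLp (fieldOf 2 cellC₂) 2 volume :=
    hfs.continuous.memLp_of_hasCompactSupport (HasCompactSupport.of_compactSpace _)
  refine crux_iff.2 ⟨fieldOf 2 cellC₂, hfs, hfd, hfm, a, E, ε, ha, hlim, hε, fun j => (hloud j).mono ?_⟩
  rintro N ⟨c, hc, h0, hE, hD⟩
  have hfN : forceCoeff (modes (Fin 3) N) (fieldOf 2 cellC₂) = fun k : ↥(modes (Fin 3) N) => cellCoeff k := by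
    rw [hfcoeff N, coeffExt_cellC₂]
  rw [← hfN] at h0
  refine ⟨fieldOf N c, steadyState_fieldOf hfmem hc h0, ?_, ?_⟩
  · rw [integral_norm_sq_fieldOf hc]; exact hE
  · rw [loudness_fieldOf (a j) hc]; exact hD

end Summit.AnomalousDissipation.AnomalousDissipation.Cruxes.GalerkinSteadyZerothLaw.EulerCoreCoatReadout

end
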